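import Summits.HodgeConjecture.HodgeConjecture.Cruxes.BlochSeedDiscOne.DepthBoundA4

/-!
# RingFourEmpty — RING 4 IS EMPTY in the kernel: `RingsEmpty 14 B rmin 4` for every budget `B ≤ 997` and every rank floor
(gs-eng-2 g59; numerics: plan-lens-HodgeAV-extremal g7 `VERTEX-STRUCTURE-extremal-g7.md` §4 K-disjunction, monad-2 g3 class map (bus l.9246),
gs-eng-2 g58 `ring4x2` (l.9570); the five functionals below were RE-DERIVED by this seat's own exact LP `work/ring4/famlp.py` — optimal values
K2 = 1218, K3 = 5989∕6, K4 = 2137, K1∕K0 infeasible, equal to extremal g7's digits — and are checked HERE by `decide`, so no number is imported on trust).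

Token: line stmt-HodgeConjecture-18881 Cruxes/BlochSeedDiscOne/Lines/birth.lean 814a6a70c14e831a stub_rung_pad4_seedAt.

THE ARGUMENT (data model of `DepthBoundA4`, height 14, all supported letters of co-level ≤ 4).
* P-letters are off-axis (`no_ample_cover_of_axis`), so `(a; |x|, |y|) ∈ {(12;1,1) =: A, (11;2,1)∕(11;1,2) =: B, (10;3,1)∕(10;1,3) =: C,
  (10;2,2) =: D}`; N-letters sit ≥ 2 co-levels higher (`colevel_drop_two`): `{(14;0,0) =: H, (13;1,0)∕(13;0,1) =: X13, (12;2,0)∕(12;0,2)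
  =: X12, (12;1,1) =: Q}`.  COVER LEMMA: a `Q` letter's only ample cover inside this alphabet is the `D` letter `(10; 2x, 2y)` below it,
  so along a live arrow `x → y` the number of `Q`-slots of `y` is at most the number of `D`-slots of `x`.
* Let `k` = the largest number of `D`-slots of a supported P-cell (`x₀` attains it).  Then every supported P-cell has `≤ k` `D`-slots and
  every supported N-cell `≤ k` `Q`-slots.
* An e-free functional `G = Σ_r g_r ρ_r` (six `S₄`-symmetric rows `ρ₂ … ρ₆`, each a zero-sum-within-degree combination of the 71 e-free
  words of degrees 2–6, hence killed by (A1): `Σ_N m·G − Σ_P m·G = 0`, `G_vanishes`) with, for `k ≥ 1`,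
  `G ≤ L` on admissible N class-tuples and `−G + Y·[#D = k] ≤ L` on admissible P class-tuples (`decide` over `4⁴ + 4⁴` tuples) gives
  `Y ≤ Y·Σ_{#D = k} m_P ≤ L·M`; the certificates have `Y > 997·L`, so `M ≤ 997` is impossible (K1: `L = 0`).
* `k = 0` (no `D` anywhere, hence no `Q`): a functional with `G ≥ L·|β₁β₂β₃β₄|` on N-cells (axis letters, `|β| ∈ {0,1,2}`) and
  `−G ≥ L·|β₁β₂β₃β₄|` on P-cells (checked as `G ≤ 0 ∧ G² ≥ L²·∏|β_f|²`) dominates `|Re|` and `|Im|` of every `eeee`-coefficient on both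
  sides at once, so `L·|Re μ| ≤ Σ_N m·G − Σ_P m·G = 0` and likewise `Im μ`: `μ = 0` — no WLOG rotation, no lattice law, no rank used.
Consequences: `ringsEmpty_colevel_four`, `ringsEmpty_14_199_8_4 : RingsEmpty 14 199 8 4`, and `a4_closed_of_depthBound_four`: the
conjecture of record relaxes from `DepthBound 14 199 8 3` to `DepthBound 14 199 8 4` (`depthBound_mono`).
`import DepthBoundA4` only; no `axiom` ∕ `instance` ∕ `sorry` ∕ `native_decide`; every finite check is a `Bool` evaluated by `decide`.
Chern-character words on a letter model ≠ sheaves ≠ the kernel of a SEED; nothing here is proved toward HC/HC_CM/HC_AV/№4/26512/18881/H2.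
-/

set_option linter.dupNamespace false
set_option autoImplicit false

namespace Summit.HodgeConjecture.HodgeConjecture.Cruxes.BlochSeedDiscOne.RingFourEmpty

open Summit.HodgeConjecture.HodgeConjecture.Cruxes.BlochSeedDiscOne.DepthBoundA4

/-! ## §0 Weighted-sum bookkeeping (`linZ L φ = Σ_{(c,m) ∈ L} m·φ(c)`) -/

theorem linZ_add (L : List (Cell × ℕ)) (φ ψ : Cell → ℤ) :
    linZ L (fun c => φ c + ψ c) = linZ L φ + linZ L ψ := by
  induction L with
  | nil => simp [linZ]
  | cons a t ih => simp only [linZ_cons]; rw [ih]; ring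

theorem linZ_smul (L : List (Cell × ℕ)) (r : ℤ) (φ : Cell → ℤ) :
    linZ L (fun c => r * φ c) = r * linZ L φ := by
  induction L with
  | nil => simp [linZ]
  | cons a t ih => simp only [linZ_cons]; rw [ih]; ring

theorem linZ_mono (L : List (Cell × ℕ)) (φ ψ : Cell → ℤ) (h : ∀ cm ∈ L, 0 < cm.2 → φ cm.1 ≤ ψ cm.1) :
    linZ L φ ≤ linZ L ψ := by
  induction L with
  | nil => simp [linZ]
  | cons a t ih =>
    rw [linZ_cons, linZ_cons]
    have ht := ih fun cm hcm => h cm (List.mem_cons_of_mem _ hcm)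
    rcases Nat.eq_zero_or_pos a.2 with h0 | hpos
    · rw [h0, Nat.cast_zero, zero_mul, zero_mul]
      linarith
    · have ha := h a List.mem_cons_self hpos
      have hm : (0 : ℤ) ≤ (a.2 : ℤ) := by exact_mod_cast Nat.zero_le _
      nlinarith

theorem abs_linZ_le (L : List (Cell × ℕ)) (φ : Cell → ℤ) : |linZ L φ| ≤ linZ L (fun c => |φ c|) := by
  induction L with
  | nil => simp [linZ]
  | cons a t ih =>
    rw [linZ_cons, linZ_cons]
    have hm : (0 : ℤ) ≤ (a.2 : ℤ) := by exact_mod_cast Nat.zero_le _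
    calc |(a.2 : ℤ) * φ a.1 + linZ t φ| ≤ |(a.2 : ℤ) * φ a.1| + |linZ t φ| := abs_add_le _ _
      _ = (a.2 : ℤ) * |φ a.1| + |linZ t φ| := by rw [abs_mul, abs_of_nonneg hm]
      _ ≤ (a.2 : ℤ) * |φ a.1| + linZ t (fun c => |φ c|) := by linarith

theorem term_le_linZ (L : List (Cell × ℕ)) (φ : Cell → ℤ) (hφ : ∀ c, 0 ≤ φ c) (c : Cell) (m : ℕ) (hmem : (c, m) ∈ L) :
    (m : ℤ) * φ c ≤ linZ L φ := by
  induction L with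
  | nil => simp at hmem
  | cons a t ih =>
    rw [linZ_cons]
    have ht0 : 0 ≤ linZ t φ := linZ_nonneg t φ fun cm _ _ => hφ cm.1
    have ha0 : 0 ≤ (a.2 : ℤ) * φ a.1 := mul_nonneg (by exact_mod_cast Nat.zero_le _) (hφ a.1)
    rcases List.mem_cons.mp hmem with heq | hmem'
    · rw [← heq]
      linarith
    · have := ih hmem'
      linarith

theorem re_linG (L : List (Cell × ℕ)) (u : Cell → GaussianInt) : (linG L u).re = linZ L (fun c => (u c).re) := by
  induction L with
  | nil => simp [linG, linZ]
  | cons a t ih => rw [linG_cons, linZ_cons, Zsqrtd.re_add, ih]; simp [Zsqrtd.re_natCast]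

theorem im_linG (L : List (Cell × ℕ)) (u : Cell → GaussianInt) : (linG L u).im = linZ L (fun c => (u c).im) := by
  induction L with
  | nil => simp [linG, linZ]
  | cons a t ih => rw [linG_cons, linZ_cons, Zsqrtd.im_add, ih]; simp [Zsqrtd.im_natCast, Zsqrtd.re_natCast]

/-! ## §1 The 71 e-free words of degrees 2–6, grouped by `S₄`-orbit, and the orbit sums -/

/-- `Bool` form of `Word.efree` (decidable by evaluation). -/
def efreeB (w : Word) : Bool := (w 0).efree && (w 1).efree && (w 2).efree && (w 3).efree

theorem efree_of_efreeB (w : Word) (h : efreeB w = true) : w.efree := by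
  intro f
  simp only [efreeB, Bool.and_eq_true] at h
  obtain ⟨⟨⟨h0, h1⟩, h2⟩, h3⟩ := h
  fin_cases f <;> assumption

/-- the 6 e-free words of type `HH` (degree 2) -/
def wordsHH : List Word :=
  [![Sym.one, Sym.one, Sym.h, Sym.h], ![Sym.one, Sym.h, Sym.one, Sym.h], ![Sym.one, Sym.h, Sym.h, Sym.one],
   ![Sym.h, Sym.one, Sym.one, Sym.h], ![Sym.h, Sym.one, Sym.h, Sym.one], ![Sym.h, Sym.h, Sym.one, Sym.one]]
set_option maxRecDepth 20000 in
theorem wordsHH_ok : ∀ w ∈ wordsHH, efreeB w = true ∧ Word.deg w = 2 := by decide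
theorem wordsHH_length : wordsHH.length = 6 := rfl

/-- the 4 e-free words of type `P` (degree 2) -/
def wordsP : List Word :=
  [![Sym.one, Sym.one, Sym.one, Sym.pt], ![Sym.one, Sym.one, Sym.pt, Sym.one], ![Sym.one, Sym.pt, Sym.one, Sym.one],
   ![Sym.pt, Sym.one, Sym.one, Sym.one]]
set_option maxRecDepth 20000 in
theorem wordsP_ok : ∀ w ∈ wordsP, efreeB w = true ∧ Word.deg w = 2 := by decide
theorem wordsP_length : wordsP.length = 4 := rfl

/-- the 4 e-free words of type `HHH` (degree 3) -/
def wordsHHH : List Word :=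
  [![Sym.one, Sym.h, Sym.h, Sym.h], ![Sym.h, Sym.one, Sym.h, Sym.h], ![Sym.h, Sym.h, Sym.one, Sym.h],
   ![Sym.h, Sym.h, Sym.h, Sym.one]]
set_option maxRecDepth 20000 in
theorem wordsHHH_ok : ∀ w ∈ wordsHHH, efreeB w = true ∧ Word.deg w = 3 := by decide
theorem wordsHHH_length : wordsHHH.length = 4 := rfl

/-- the 12 e-free words of type `PH` (degree 3) -/
def wordsPH : List Word :=
  [![Sym.one, Sym.one, Sym.h, Sym.pt], ![Sym.one, Sym.one, Sym.pt, Sym.h], ![Sym.one, Sym.h, Sym.one, Sym.pt],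
   ![Sym.one, Sym.h, Sym.pt, Sym.one], ![Sym.one, Sym.pt, Sym.one, Sym.h], ![Sym.one, Sym.pt, Sym.h, Sym.one],
   ![Sym.h, Sym.one, Sym.one, Sym.pt], ![Sym.h, Sym.one, Sym.pt, Sym.one], ![Sym.h, Sym.pt, Sym.one, Sym.one],
   ![Sym.pt, Sym.one, Sym.one, Sym.h], ![Sym.pt, Sym.one, Sym.h, Sym.one], ![Sym.pt, Sym.h, Sym.one, Sym.one]]
set_option maxRecDepth 20000 in
theorem wordsPH_ok : ∀ w ∈ wordsPH, efreeB w = true ∧ Word.deg w = 3 := by decide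
theorem wordsPH_length : wordsPH.length = 12 := rfl

/-- the 1 e-free words of type `HHHH` (degree 4) -/
def wordsHHHH : List Word :=
  [![Sym.h, Sym.h, Sym.h, Sym.h]]
set_option maxRecDepth 20000 in
theorem wordsHHHH_ok : ∀ w ∈ wordsHHHH, efreeB w = true ∧ Word.deg w = 4 := by decide
theorem wordsHHHH_length : wordsHHHH.length = 1 := rfl

/-- the 12 e-free words of type `PHH` (degree 4) -/
def wordsPHH : List Word :=
  [![Sym.one, Sym.h, Sym.h, Sym.pt], ![Sym.one, Sym.h, Sym.pt, Sym.h], ![Sym.one, Sym.pt, Sym.h, Sym.h],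
   ![Sym.h, Sym.one, Sym.h, Sym.pt], ![Sym.h, Sym.one, Sym.pt, Sym.h], ![Sym.h, Sym.h, Sym.one, Sym.pt],
   ![Sym.h, Sym.h, Sym.pt, Sym.one], ![Sym.h, Sym.pt, Sym.one, Sym.h], ![Sym.h, Sym.pt, Sym.h, Sym.one],
   ![Sym.pt, Sym.one, Sym.h, Sym.h], ![Sym.pt, Sym.h, Sym.one, Sym.h], ![Sym.pt, Sym.h, Sym.h, Sym.one]]
set_option maxRecDepth 20000 in
theorem wordsPHH_ok : ∀ w ∈ wordsPHH, efreeB w = true ∧ Word.deg w = 4 := by decide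
theorem wordsPHH_length : wordsPHH.length = 12 := rfl

/-- the 6 e-free words of type `PP` (degree 4) -/
def wordsPP : List Word :=
  [![Sym.one, Sym.one, Sym.pt, Sym.pt], ![Sym.one, Sym.pt, Sym.one, Sym.pt], ![Sym.one, Sym.pt, Sym.pt, Sym.one],
   ![Sym.pt, Sym.one, Sym.one, Sym.pt], ![Sym.pt, Sym.one, Sym.pt, Sym.one], ![Sym.pt, Sym.pt, Sym.one, Sym.one]]
set_option maxRecDepth 20000 in
theorem wordsPP_ok : ∀ w ∈ wordsPP, efreeB w = true ∧ Word.deg w = 4 := by decide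
theorem wordsPP_length : wordsPP.length = 6 := rfl

/-- the 4 e-free words of type `PHHH` (degree 5) -/
def wordsPHHH : List Word :=
  [![Sym.h, Sym.h, Sym.h, Sym.pt], ![Sym.h, Sym.h, Sym.pt, Sym.h], ![Sym.h, Sym.pt, Sym.h, Sym.h],
   ![Sym.pt, Sym.h, Sym.h, Sym.h]]
set_option maxRecDepth 20000 in
theorem wordsPHHH_ok : ∀ w ∈ wordsPHHH, efreeB w = true ∧ Word.deg w = 5 := by decide
theorem wordsPHHH_length : wordsPHHH.length = 4 := rfl

/-- the 12 e-free words of type `PPH` (degree 5) -/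
def wordsPPH : List Word :=
  [![Sym.one, Sym.h, Sym.pt, Sym.pt], ![Sym.one, Sym.pt, Sym.h, Sym.pt], ![Sym.one, Sym.pt, Sym.pt, Sym.h],
   ![Sym.h, Sym.one, Sym.pt, Sym.pt], ![Sym.h, Sym.pt, Sym.one, Sym.pt], ![Sym.h, Sym.pt, Sym.pt, Sym.one],
   ![Sym.pt, Sym.one, Sym.h, Sym.pt], ![Sym.pt, Sym.one, Sym.pt, Sym.h], ![Sym.pt, Sym.h, Sym.one, Sym.pt],
   ![Sym.pt, Sym.h, Sym.pt, Sym.one], ![Sym.pt, Sym.pt, Sym.one, Sym.h], ![Sym.pt, Sym.pt, Sym.h, Sym.one]]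
set_option maxRecDepth 20000 in
theorem wordsPPH_ok : ∀ w ∈ wordsPPH, efreeB w = true ∧ Word.deg w = 5 := by decide
theorem wordsPPH_length : wordsPPH.length = 12 := rfl

/-- the 6 e-free words of type `PPHH` (degree 6) -/
def wordsPPHH : List Word :=
  [![Sym.h, Sym.h, Sym.pt, Sym.pt], ![Sym.h, Sym.pt, Sym.h, Sym.pt], ![Sym.h, Sym.pt, Sym.pt, Sym.h],
   ![Sym.pt, Sym.h, Sym.h, Sym.pt], ![Sym.pt, Sym.h, Sym.pt, Sym.h], ![Sym.pt, Sym.pt, Sym.h, Sym.h]]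
set_option maxRecDepth 20000 in
theorem wordsPPHH_ok : ∀ w ∈ wordsPPHH, efreeB w = true ∧ Word.deg w = 6 := by decide
theorem wordsPPHH_length : wordsPPHH.length = 6 := rfl

/-- the 4 e-free words of type `PPP` (degree 6) -/
def wordsPPP : List Word :=
  [![Sym.one, Sym.pt, Sym.pt, Sym.pt], ![Sym.pt, Sym.one, Sym.pt, Sym.pt], ![Sym.pt, Sym.pt, Sym.one, Sym.pt],
   ![Sym.pt, Sym.pt, Sym.pt, Sym.one]]
set_option maxRecDepth 20000 in
theorem wordsPPP_ok : ∀ w ∈ wordsPPP, efreeB w = true ∧ Word.deg w = 6 := by decide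
theorem wordsPPP_length : wordsPPP.length = 4 := rfl



/-- Orbit sum: `Σ_{w ∈ ws} icellCoef c w`. -/
def SO (ws : List Word) (c : Cell) : ℤ := (ws.map fun w => icellCoef c w).sum

theorem SO_nil (c : Cell) : SO [] c = 0 := rfl

theorem SO_cons (w : Word) (ws : List Word) (c : Cell) : SO (w :: ws) c = icellCoef c w + SO ws c := by
  simp [SO]

/-- Under (A1), the row of one orbit: `Σ_N m·SO − Σ_P m·SO = |orbit| · Tz(reference word of that degree)`. -/
theorem orbit_row (D : Design) (h1 : D.A1) (ref : Word) (href : efreeB ref = true) (d : ℕ) (hd : ref.deg = d)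
    (ws : List Word) (hws : ∀ w ∈ ws, efreeB w = true ∧ Word.deg w = d) :
    linZ D.N (SO ws) - linZ D.P (SO ws) = (ws.length : ℤ) * D.Tz ref := by
  induction ws with
  | nil => simp [SO, linZ]
  | cons w t ih =>
    have hw := hws w List.mem_cons_self
    have ht := ih fun w' hw' => hws w' (List.mem_cons_of_mem _ hw')
    have hTz : D.Tz w = D.Tz ref :=
      Tz_eq_of_A1 D h1 w ref (efree_of_efreeB w hw.1) (efree_of_efreeB ref href) (hw.2.trans hd.symm)
    have eN : linZ D.N (SO (w :: t)) = linZ D.N (fun c => icellCoef c w) + linZ D.N (SO t) := by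
      rw [← linZ_add]; rfl
    have eP : linZ D.P (SO (w :: t)) = linZ D.P (fun c => icellCoef c w) + linZ D.P (SO t) := by
      rw [← linZ_add]; rfl
    rw [eN, eP, List.length_cons, Nat.cast_succ]
    unfold Design.Tz at hTz ht ⊢
    linear_combination hTz + ht

/-! ### The eleven orbit polynomials in the levels `a_f` and the `pt`-coefficients `n_f = a_f² − b_f` -/

/-- `e₂(a)` -/
def oHH (a0 _n0 a1 _n1 a2 _n2 a3 _n3 : ℤ) : ℤ := a0*a1 + a0*a2 + a0*a3 + a1*a2 + a1*a3 + a2*a3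
/-- `Σ n` -/
def oP (_a0 n0 _a1 n1 _a2 n2 _a3 n3 : ℤ) : ℤ := n0 + n1 + n2 + n3
/-- `e₃(a)` -/
def oHHH (a0 _n0 a1 _n1 a2 _n2 a3 _n3 : ℤ) : ℤ := a0*a1*a2 + a0*a1*a3 + a0*a2*a3 + a1*a2*a3
/-- `Σ_{f ≠ g} n_f a_g` -/
def oPH (a0 n0 a1 n1 a2 n2 a3 n3 : ℤ) : ℤ := n0*(a1+a2+a3) + n1*(a0+a2+a3) + n2*(a0+a1+a3) + n3*(a0+a1+a2)
/-- `e₄(a)` -/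
def oHHHH (a0 _n0 a1 _n1 a2 _n2 a3 _n3 : ℤ) : ℤ := a0*a1*a2*a3
/-- `Σ_f n_f e₂(a_{≠f})` -/
def oPHH (a0 n0 a1 n1 a2 n2 a3 n3 : ℤ) : ℤ :=
  n0*(a1*a2 + a1*a3 + a2*a3) + n1*(a0*a2 + a0*a3 + a2*a3) + n2*(a0*a1 + a0*a3 + a1*a3) + n3*(a0*a1 + a0*a2 + a1*a2)
/-- `e₂(n)` -/
def oPP (_a0 n0 _a1 n1 _a2 n2 _a3 n3 : ℤ) : ℤ := n0*n1 + n0*n2 + n0*n3 + n1*n2 + n1*n3 + n2*n3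
/-- `Σ_f n_f e₃(a_{≠f})` -/
def oPHHH (a0 n0 a1 n1 a2 n2 a3 n3 : ℤ) : ℤ := n0*a1*a2*a3 + n1*a0*a2*a3 + n2*a0*a1*a3 + n3*a0*a1*a2
/-- `Σ_{f<g} n_f n_g e₁(a_{≠f,g})` -/
def oPPH (a0 n0 a1 n1 a2 n2 a3 n3 : ℤ) : ℤ :=
  n0*n1*(a2+a3) + n0*n2*(a1+a3) + n0*n3*(a1+a2) + n1*n2*(a0+a3) + n1*n3*(a0+a2) + n2*n3*(a0+a1)
/-- `Σ_{f<g} n_f n_g e₂(a_{≠f,g})` -/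
def oPPHH (a0 n0 a1 n1 a2 n2 a3 n3 : ℤ) : ℤ := n0*n1*a2*a3 + n0*n2*a1*a3 + n0*n3*a1*a2 + n1*n2*a0*a3 + n1*n3*a0*a2 + n2*n3*a0*a1
/-- `e₃(n)` -/
def oPPP (_a0 n0 _a1 n1 _a2 n2 _a3 n3 : ℤ) : ℤ := n0*n1*n2 + n0*n1*n3 + n0*n2*n3 + n1*n2*n3

theorem SO_HH (c : Cell) : SO wordsHH c =
    oHH (c 0).a (c 0).selfInt (c 1).a (c 1).selfInt (c 2).a (c 2).selfInt (c 3).a (c 3).selfInt := by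
  simp [SO, wordsHH, icellCoef, Fin.prod_univ_four, Sym.icoef, oHH]; ring
theorem SO_P (c : Cell) : SO wordsP c =
    oP (c 0).a (c 0).selfInt (c 1).a (c 1).selfInt (c 2).a (c 2).selfInt (c 3).a (c 3).selfInt := by
  simp [SO, wordsP, icellCoef, Fin.prod_univ_four, Sym.icoef, oP]; ring
theorem SO_HHH (c : Cell) : SO wordsHHH c =
    oHHH (c 0).a (c 0).selfInt (c 1).a (c 1).selfInt (c 2).a (c 2).selfInt (c 3).a (c 3).selfInt := by
  simp [SO, wordsHHH, icellCoef, Fin.prod_univ_four, Sym.icoef, oHHH]; ring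
theorem SO_PH (c : Cell) : SO wordsPH c =
    oPH (c 0).a (c 0).selfInt (c 1).a (c 1).selfInt (c 2).a (c 2).selfInt (c 3).a (c 3).selfInt := by
  simp [SO, wordsPH, icellCoef, Fin.prod_univ_four, Sym.icoef, oPH]; ring
theorem SO_HHHH (c : Cell) : SO wordsHHHH c =
    oHHHH (c 0).a (c 0).selfInt (c 1).a (c 1).selfInt (c 2).a (c 2).selfInt (c 3).a (c 3).selfInt := by
  simp [SO, wordsHHHH, icellCoef, Fin.prod_univ_four, Sym.icoef, oHHHH]
theorem SO_PHH (c : Cell) : SO wordsPHH c =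
    oPHH (c 0).a (c 0).selfInt (c 1).a (c 1).selfInt (c 2).a (c 2).selfInt (c 3).a (c 3).selfInt := by
  simp [SO, wordsPHH, icellCoef, Fin.prod_univ_four, Sym.icoef, oPHH]; ring
theorem SO_PP (c : Cell) : SO wordsPP c =
    oPP (c 0).a (c 0).selfInt (c 1).a (c 1).selfInt (c 2).a (c 2).selfInt (c 3).a (c 3).selfInt := by
  simp [SO, wordsPP, icellCoef, Fin.prod_univ_four, Sym.icoef, oPP]; ring
theorem SO_PHHH (c : Cell) : SO wordsPHHH c =
    oPHHH (c 0).a (c 0).selfInt (c 1).a (c 1).selfInt (c 2).a (c 2).selfInt (c 3).a (c 3).selfInt := by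
  simp [SO, wordsPHHH, icellCoef, Fin.prod_univ_four, Sym.icoef, oPHHH]; ring
theorem SO_PPH (c : Cell) : SO wordsPPH c =
    oPPH (c 0).a (c 0).selfInt (c 1).a (c 1).selfInt (c 2).a (c 2).selfInt (c 3).a (c 3).selfInt := by
  simp [SO, wordsPPH, icellCoef, Fin.prod_univ_four, Sym.icoef, oPPH]; ring
theorem SO_PPHH (c : Cell) : SO wordsPPHH c =
    oPPHH (c 0).a (c 0).selfInt (c 1).a (c 1).selfInt (c 2).a (c 2).selfInt (c 3).a (c 3).selfInt := by
  simp [SO, wordsPPHH, icellCoef, Fin.prod_univ_four, Sym.icoef, oPPHH]; ring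
theorem SO_PPP (c : Cell) : SO wordsPPP c =
    oPPP (c 0).a (c 0).selfInt (c 1).a (c 1).selfInt (c 2).a (c 2).selfInt (c 3).a (c 3).selfInt := by
  simp [SO, wordsPPP, icellCoef, Fin.prod_univ_four, Sym.icoef, oPPP]; ring

/-! ## §2 The functional `G = Σ_r g_r ρ_r` and its (A1)-vanishing -/

/-- Six row multipliers (for `ρ₂, ρ₃, ρ₄a, ρ₄b, ρ₅, ρ₆`). -/
structure Coefs where
  g2 : ℤ
  g3 : ℤ
  g4 : ℤ
  g5 : ℤ
  g6 : ℤ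
  g7 : ℤ

/-- `G` as a polynomial in the class data `(a_f, n_f)`; the rows are `ρ₂ = 2e₂(a) − 3Σn` (= `4·[hh] − 6·[pt]` over orderings), `ρ₃ = 3e₃(a) − Σ_{f≠g} n_f a_g`,
`ρ₄a = 12e₄(a) − Σ n_f e₂(a_{≠f})`, `ρ₄b = Σ n_f e₂(a_{≠f}) − 2e₂(n)`, `ρ₅ = 3Σ n_f e₃(a_{≠f}) − Σ n_f n_g e₁`, `ρ₆ = 2Σ n_f n_g e₂ − 3e₃(n)` —
each `|O′|·(orbit O) − |O|·(orbit O′)` for two orbits of one degree, divided by the gcd. -/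
def Gpoly (γ : Coefs) (a0 n0 a1 n1 a2 n2 a3 n3 : ℤ) : ℤ :=
  γ.g2 * (2 * oHH a0 n0 a1 n1 a2 n2 a3 n3 - 3 * oP a0 n0 a1 n1 a2 n2 a3 n3)
  + γ.g3 * (3 * oHHH a0 n0 a1 n1 a2 n2 a3 n3 - oPH a0 n0 a1 n1 a2 n2 a3 n3)
  + γ.g4 * (12 * oHHHH a0 n0 a1 n1 a2 n2 a3 n3 - oPHH a0 n0 a1 n1 a2 n2 a3 n3)
  + γ.g5 * (oPHH a0 n0 a1 n1 a2 n2 a3 n3 - 2 * oPP a0 n0 a1 n1 a2 n2 a3 n3)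
  + γ.g6 * (3 * oPHHH a0 n0 a1 n1 a2 n2 a3 n3 - oPPH a0 n0 a1 n1 a2 n2 a3 n3)
  + γ.g7 * (2 * oPPHH a0 n0 a1 n1 a2 n2 a3 n3 - 3 * oPPP a0 n0 a1 n1 a2 n2 a3 n3)

/-- `G` of a cell. -/
def Gcell (γ : Coefs) (c : Cell) : ℤ :=
  Gpoly γ (c 0).a (c 0).selfInt (c 1).a (c 1).selfInt (c 2).a (c 2).selfInt (c 3).a (c 3).selfInt

theorem Gcell_eq (γ : Coefs) (c : Cell) : Gcell γ c =
    γ.g2 * (2 * SO wordsHH c - 3 * SO wordsP c) + γ.g3 * (3 * SO wordsHHH c - SO wordsPH c)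
    + γ.g4 * (12 * SO wordsHHHH c - SO wordsPHH c) + γ.g5 * (SO wordsPHH c - 2 * SO wordsPP c)
    + γ.g6 * (3 * SO wordsPHHH c - SO wordsPPH c) + γ.g7 * (2 * SO wordsPPHH c - 3 * SO wordsPPP c) := by
  rw [SO_HH, SO_P, SO_HHH, SO_PH, SO_HHHH, SO_PHH, SO_PP, SO_PHHH, SO_PPH, SO_PPHH, SO_PPP]
  rfl

theorem linZ_Gcell (L : List (Cell × ℕ)) (γ : Coefs) : linZ L (Gcell γ) =
    γ.g2 * (2 * linZ L (SO wordsHH) - 3 * linZ L (SO wordsP)) + γ.g3 * (3 * linZ L (SO wordsHHH) - linZ L (SO wordsPH))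
    + γ.g4 * (12 * linZ L (SO wordsHHHH) - linZ L (SO wordsPHH)) + γ.g5 * (linZ L (SO wordsPHH) - 2 * linZ L (SO wordsPP))
    + γ.g6 * (3 * linZ L (SO wordsPHHH) - linZ L (SO wordsPPH)) + γ.g7 * (2 * linZ L (SO wordsPPHH) - 3 * linZ L (SO wordsPPP)) := by
  induction L with
  | nil => simp [linZ]
  | cons a t ih => simp only [linZ_cons]; rw [ih, Gcell_eq]; ring

/-- reference words, one per degree -/
def ref2 : Word := ![Sym.pt, Sym.one, Sym.one, Sym.one]
/-- degree 3 -/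
def ref3 : Word := ![Sym.h, Sym.h, Sym.h, Sym.one]
/-- degree 4 -/
def ref4 : Word := ![Sym.h, Sym.h, Sym.h, Sym.h]
/-- degree 5 -/
def ref5 : Word := ![Sym.pt, Sym.h, Sym.h, Sym.h]
/-- degree 6 -/
def ref6 : Word := ![Sym.pt, Sym.pt, Sym.h, Sym.h]

/-- **(A1) kills every functional of this shape**: `Σ_N m·G − Σ_P m·G = 0`. -/
theorem G_vanishes (D : Design) (h1 : D.A1) (γ : Coefs) : linZ D.N (Gcell γ) - linZ D.P (Gcell γ) = 0 := by
  have rHH := orbit_row D h1 ref2 (by decide) 2 (by decide) wordsHH wordsHH_ok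
  have rP := orbit_row D h1 ref2 (by decide) 2 (by decide) wordsP wordsP_ok
  have rHHH := orbit_row D h1 ref3 (by decide) 3 (by decide) wordsHHH wordsHHH_ok
  have rPH := orbit_row D h1 ref3 (by decide) 3 (by decide) wordsPH wordsPH_ok
  have rHHHH := orbit_row D h1 ref4 (by decide) 4 (by decide) wordsHHHH wordsHHHH_ok
  have rPHH := orbit_row D h1 ref4 (by decide) 4 (by decide) wordsPHH wordsPHH_ok
  have rPP := orbit_row D h1 ref4 (by decide) 4 (by decide) wordsPP wordsPP_ok
  have rPHHH := orbit_row D h1 ref5 (by decide) 5 (by decide) wordsPHHH wordsPHHH_ok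
  have rPPH := orbit_row D h1 ref5 (by decide) 5 (by decide) wordsPPH wordsPPH_ok
  have rPPHH := orbit_row D h1 ref6 (by decide) 6 (by decide) wordsPPHH wordsPPHH_ok
  have rPPP := orbit_row D h1 ref6 (by decide) 6 (by decide) wordsPPP wordsPPP_ok
  rw [wordsHH_length] at rHH; rw [wordsP_length] at rP; rw [wordsHHH_length] at rHHH; rw [wordsPH_length] at rPH
  rw [wordsHHHH_length] at rHHHH; rw [wordsPHH_length] at rPHH; rw [wordsPP_length] at rPP; rw [wordsPHHH_length] at rPHHH
  rw [wordsPPH_length] at rPPH; rw [wordsPPHH_length] at rPPHH; rw [wordsPPP_length] at rPPP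
  rw [linZ_Gcell, linZ_Gcell]
  push_cast at *
  linear_combination γ.g2 * (2 * rHH - 3 * rP) + γ.g3 * (3 * rHHH - rPH) + γ.g4 * (12 * rHHHH - rPHH)
    + γ.g5 * (rPHH - 2 * rPP) + γ.g6 * (3 * rPHHH - rPPH) + γ.g7 * (2 * rPPHH - 3 * rPPP)

/-! ## §3 Letter classes at co-level ≤ 4, their class data, and the finite checks (`Bool`, evaluated by `decide`) -/

/-- P-letter classes: `A = (12;1,1)`, `B = (11;2,1)∕(11;1,2)`, `C = (10;3,1)∕(10;1,3)`, `D = (10;2,2)`. -/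
inductive PC where
  | A | B | C | D
deriving DecidableEq, Repr

/-- level `a` -/
def PC.av : PC → ℤ
  | A => 12 | B => 11 | C => 10 | D => 10
/-- `n = a² − b` -/
def PC.nv : PC → ℤ
  | A => 142 | B => 116 | C => 90 | D => 92
/-- `b = |β|²` -/
def PC.bv : PC → ℤ
  | A => 2 | B => 5 | C => 10 | D => 8
/-- the class `D` -/
def PC.isD : PC → Bool
  | D => true | _ => false

/-- N-letter classes: `H = (14;0,0)`, `X13 = (13;1,0)∕(13;0,1)`, `X12 = (12;2,0)∕(12;0,2)`, `Q = (12;1,1)`. -/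
inductive NC where
  | H | X13 | X12 | Q
deriving DecidableEq, Repr

/-- level `a` -/
def NC.av : NC → ℤ
  | H => 14 | X13 => 13 | X12 => 12 | Q => 12
/-- `n = a² − b` -/
def NC.nv : NC → ℤ
  | H => 196 | X13 => 168 | X12 => 140 | Q => 142
/-- `|β|` for the axis classes (unused for `Q`) -/
def NC.sv : NC → ℤ
  | H => 0 | X13 => 1 | X12 => 2 | Q => 0
/-- the class `Q` -/
def NC.isQ : NC → Bool
  | Q => true | _ => false

theorem NC.sv_nonneg (K : NC) : 0 ≤ K.sv := by cases K <;> decide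

/-- `∀` over `PC` as a `Bool`. -/
def allPC (p : PC → Bool) : Bool := p PC.A && p PC.B && p PC.C && p PC.D
/-- `∀` over `NC` as a `Bool`. -/
def allNC (p : NC → Bool) : Bool := p NC.H && p NC.X13 && p NC.X12 && p NC.Q

theorem allPC_spec (p : PC → Bool) (h : allPC p = true) (k : PC) : p k = true := by
  simp only [allPC, Bool.and_eq_true] at h
  obtain ⟨⟨⟨hA, hB⟩, hC⟩, hD⟩ := h
  cases k <;> assumption

theorem allNC_spec (p : NC → Bool) (h : allNC p = true) (k : NC) : p k = true := by
  simp only [allNC, Bool.and_eq_true] at h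
  obtain ⟨⟨⟨hA, hB⟩, hC⟩, hD⟩ := h
  cases k <;> assumption

/-- `G` on a P class-tuple. -/
def GP (γ : Coefs) (k0 k1 k2 k3 : PC) : ℤ := Gpoly γ k0.av k0.nv k1.av k1.nv k2.av k2.nv k3.av k3.nv
/-- `G` on an N class-tuple. -/
def GN (γ : Coefs) (k0 k1 k2 k3 : NC) : ℤ := Gpoly γ k0.av k0.nv k1.av k1.nv k2.av k2.nv k3.av k3.nv
/-- number of `D` slots -/
def cntD (k0 k1 k2 k3 : PC) : ℕ := k0.isD.toNat + k1.isD.toNat + k2.isD.toNat + k3.isD.toNat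
/-- number of `Q` slots -/
def cntQ (k0 k1 k2 k3 : NC) : ℕ := k0.isQ.toNat + k1.isQ.toNat + k2.isQ.toNat + k3.isQ.toNat

/-- P-side check of branch `k ≥ 1`: `−G + Y·[#D = k] ≤ L` on tuples with `#D ≤ k`. -/
def chkP (k : ℕ) (γ : Coefs) (L Y : ℤ) : Bool :=
  allPC fun k0 => allPC fun k1 => allPC fun k2 => allPC fun k3 =>
    decide (cntD k0 k1 k2 k3 ≤ k → -GP γ k0 k1 k2 k3 + Y * (if cntD k0 k1 k2 k3 = k then 1 else 0) ≤ L)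

/-- N-side check of branch `k ≥ 1`: `G ≤ L` on tuples with `#Q ≤ k`. -/
def chkN (k : ℕ) (γ : Coefs) (L : ℤ) : Bool :=
  allNC fun k0 => allNC fun k1 => allNC fun k2 => allNC fun k3 =>
    decide (cntQ k0 k1 k2 k3 ≤ k → GN γ k0 k1 k2 k3 ≤ L)

/-- P-side check of branch `0`: `G ≤ 0 ∧ L²·∏ b ≤ G²` on `D`-free tuples. -/
def chkP0 (γ : Coefs) (L : ℤ) : Bool :=
  allPC fun k0 => allPC fun k1 => allPC fun k2 => allPC fun k3 =>
    decide (cntD k0 k1 k2 k3 = 0 → GP γ k0 k1 k2 k3 ≤ 0 ∧ L ^ 2 * (k0.bv * k1.bv * k2.bv * k3.bv) ≤ GP γ k0 k1 k2 k3 ^ 2)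

/-- N-side check of branch `0`: `L·∏ |β| ≤ G` on `Q`-free tuples. -/
def chkN0 (γ : Coefs) (L : ℤ) : Bool :=
  allNC fun k0 => allNC fun k1 => allNC fun k2 => allNC fun k3 =>
    decide (cntQ k0 k1 k2 k3 = 0 → L * (k0.sv * k1.sv * k2.sv * k3.sv) ≤ GN γ k0 k1 k2 k3)

theorem chkP_spec (k : ℕ) (γ : Coefs) (L Y : ℤ) (h : chkP k γ L Y = true) (k0 k1 k2 k3 : PC) (hk : cntD k0 k1 k2 k3 ≤ k) :
    -GP γ k0 k1 k2 k3 + Y * (if cntD k0 k1 k2 k3 = k then 1 else 0) ≤ L :=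
  of_decide_eq_true (allPC_spec _ (allPC_spec _ (allPC_spec _ (allPC_spec _ h k0) k1) k2) k3) hk

theorem chkN_spec (k : ℕ) (γ : Coefs) (L : ℤ) (h : chkN k γ L = true) (k0 k1 k2 k3 : NC) (hk : cntQ k0 k1 k2 k3 ≤ k) :
    GN γ k0 k1 k2 k3 ≤ L :=
  of_decide_eq_true (allNC_spec _ (allNC_spec _ (allNC_spec _ (allNC_spec _ h k0) k1) k2) k3) hk

theorem chkP0_spec (γ : Coefs) (L : ℤ) (h : chkP0 γ L = true) (k0 k1 k2 k3 : PC) (hk : cntD k0 k1 k2 k3 = 0) :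
    GP γ k0 k1 k2 k3 ≤ 0 ∧ L ^ 2 * (k0.bv * k1.bv * k2.bv * k3.bv) ≤ GP γ k0 k1 k2 k3 ^ 2 :=
  of_decide_eq_true (allPC_spec _ (allPC_spec _ (allPC_spec _ (allPC_spec _ h k0) k1) k2) k3) hk

theorem chkN0_spec (γ : Coefs) (L : ℤ) (h : chkN0 γ L = true) (k0 k1 k2 k3 : NC) (hk : cntQ k0 k1 k2 k3 = 0) :
    L * (k0.sv * k1.sv * k2.sv * k3.sv) ≤ GN γ k0 k1 k2 k3 :=
  of_decide_eq_true (allNC_spec _ (allNC_spec _ (allNC_spec _ (allNC_spec _ h k0) k1) k2) k3) hk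

/-! ### The five certificates (found by the exact LP `work/ring4/famlp.py` of gs-eng-2 g59; values = extremal g7 §4: K1∕K0 infeasible,
min M = 1218 ∕ 5989⁄6 ∕ 2137 for K2 ∕ K3 ∕ K4; here `Y∕L` = 234240∕0, 29232∕24 = 1218, 574944∕576 = 5989⁄6, 410304∕192 = 2137). -/

/-- branch 1 -/
def γ1 : Coefs := ⟨249704, 249704, -41209, -20825, 4676, -115⟩
/-- branch 2 -/
def γ2 : Coefs := ⟨1199012, -336720, 23611, 11823, -1656, 29⟩
/-- branch 3 -/
def γ3 : Coefs := ⟨19426892, -5638252, 409091, 204652, -29698, 539⟩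
/-- branch 4 -/
def γ4 : Coefs := ⟨4759716, -1389156, 101345, 50708, -7398, 135⟩
/-- branch 0 -/
def γ0 : Coefs := ⟨-7598136, -7598136, -7598136, -7598136, 2454925, -94853⟩

theorem chkN1_ok : chkN 1 γ1 0 = true := by decide
theorem chkP1_ok : chkP 1 γ1 0 234240 = true := by decide
theorem chkN2_ok : chkN 2 γ2 24 = true := by decide
theorem chkP2_ok : chkP 2 γ2 24 29232 = true := by decide
theorem chkN3_ok : chkN 3 γ3 576 = true := by decide
theorem chkP3_ok : chkP 3 γ3 576 574944 = true := by decide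
theorem chkN4_ok : chkN 4 γ4 192 = true := by decide
theorem chkP4_ok : chkP 4 γ4 192 410304 = true := by decide
theorem chkN0_ok : chkN0 γ0 7598136 = true := by decide
theorem chkP0_ok : chkP0 γ0 7598136 = true := by decide

/-! ## §4 Letter shapes: P-letters (off-axis, co-level ≤ 4), N-letters (co-level ≤ 2), the COVER LEMMA -/

/-- a `D` letter `(10; ±2, ±2)` -/
def isD (ℓ : Letter) : Bool := decide (ℓ.a = 10) && decide (|ℓ.x| = 2) && decide (|ℓ.y| = 2)
/-- a `Q` letter `(12; ±1, ±1)` -/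
def isQ (ℓ : Letter) : Bool := decide (ℓ.a = 12) && decide (|ℓ.x| = 1) && decide (|ℓ.y| = 1)

/-- admissible P-letter at ring 4 -/
def PAdm (ℓ : Letter) : Prop := ℓ.OnAlphabet 14 ∧ ℓ.colevel ≤ 4 ∧ ℓ.x ≠ 0 ∧ ℓ.y ≠ 0
/-- admissible N-letter at ring 4 -/
def NAdm (ℓ : Letter) : Prop := ℓ.OnAlphabet 14 ∧ ℓ.colevel ≤ 2

/-- `ℓ` has the class data of `K`. -/
def PRep (ℓ : Letter) (K : PC) : Prop := ℓ.a = K.av ∧ ℓ.selfInt = K.nv ∧ ℓ.bnorm = K.bv ∧ isD ℓ = K.isD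
/-- `ℓ` has the class data of `K` (N side). -/
def NRep (ℓ : Letter) (K : NC) : Prop := ℓ.a = K.av ∧ ℓ.selfInt = K.nv ∧ isQ ℓ = K.isQ ∧ (K.isQ = false → ℓ.bnorm = K.sv ^ 2)

theorem exists_PRep {ℓ : Letter} (h : PAdm ℓ) : ∃ K : PC, PRep ℓ K := by
  obtain ⟨⟨hh, _⟩, hc, hx, hy⟩ := h
  unfold Letter.height at hh
  unfold Letter.colevel at hc
  have hx1 : 1 ≤ |ℓ.x| := Int.one_le_abs hx
  have hy1 : 1 ≤ |ℓ.y| := Int.one_le_abs hy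
  have hx2 : ℓ.x ^ 2 = |ℓ.x| ^ 2 := (sq_abs ℓ.x).symm
  have hy2 : ℓ.y ^ 2 = |ℓ.y| ^ 2 := (sq_abs ℓ.y).symm
  unfold PRep isD Letter.selfInt Letter.bnorm
  rw [hx2, hy2]
  rcases (show (|ℓ.x| = 1 ∧ |ℓ.y| = 1) ∨ (|ℓ.x| = 2 ∧ |ℓ.y| = 1) ∨ (|ℓ.x| = 1 ∧ |ℓ.y| = 2) ∨ (|ℓ.x| = 3 ∧ |ℓ.y| = 1)
      ∨ (|ℓ.x| = 1 ∧ |ℓ.y| = 3) ∨ (|ℓ.x| = 2 ∧ |ℓ.y| = 2) by omega) with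
    ⟨hu, hv⟩ | ⟨hu, hv⟩ | ⟨hu, hv⟩ | ⟨hu, hv⟩ | ⟨hu, hv⟩ | ⟨hu, hv⟩
  · exact ⟨PC.A, by rw [hu, hv, show ℓ.a = 12 by omega]; decide⟩
  · exact ⟨PC.B, by rw [hu, hv, show ℓ.a = 11 by omega]; decide⟩
  · exact ⟨PC.B, by rw [hu, hv, show ℓ.a = 11 by omega]; decide⟩
  · exact ⟨PC.C, by rw [hu, hv, show ℓ.a = 10 by omega]; decide⟩
  · exact ⟨PC.C, by rw [hu, hv, show ℓ.a = 10 by omega]; decide⟩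
  · exact ⟨PC.D, by rw [hu, hv, show ℓ.a = 10 by omega]; decide⟩

theorem exists_NRep {ℓ : Letter} (h : NAdm ℓ) : ∃ K : NC, NRep ℓ K := by
  obtain ⟨⟨hh, _⟩, hc⟩ := h
  unfold Letter.height at hh
  unfold Letter.colevel at hc
  have hx0 := abs_nonneg ℓ.x
  have hy0 := abs_nonneg ℓ.y
  have hx2 : ℓ.x ^ 2 = |ℓ.x| ^ 2 := (sq_abs ℓ.x).symm
  have hy2 : ℓ.y ^ 2 = |ℓ.y| ^ 2 := (sq_abs ℓ.y).symm
  unfold NRep isQ Letter.selfInt Letter.bnorm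
  rw [hx2, hy2]
  rcases (show (|ℓ.x| = 0 ∧ |ℓ.y| = 0) ∨ (|ℓ.x| = 1 ∧ |ℓ.y| = 0) ∨ (|ℓ.x| = 0 ∧ |ℓ.y| = 1) ∨ (|ℓ.x| = 2 ∧ |ℓ.y| = 0)
      ∨ (|ℓ.x| = 0 ∧ |ℓ.y| = 2) ∨ (|ℓ.x| = 1 ∧ |ℓ.y| = 1) by omega) with
    ⟨hu, hv⟩ | ⟨hu, hv⟩ | ⟨hu, hv⟩ | ⟨hu, hv⟩ | ⟨hu, hv⟩ | ⟨hu, hv⟩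
  · exact ⟨NC.H, by rw [hu, hv, show ℓ.a = 14 by omega]; decide⟩
  · exact ⟨NC.X13, by rw [hu, hv, show ℓ.a = 13 by omega]; decide⟩
  · exact ⟨NC.X13, by rw [hu, hv, show ℓ.a = 13 by omega]; decide⟩
  · exact ⟨NC.X12, by rw [hu, hv, show ℓ.a = 12 by omega]; decide⟩
  · exact ⟨NC.X12, by rw [hu, hv, show ℓ.a = 12 by omega]; decide⟩
  · exact ⟨NC.Q, by rw [hu, hv, show ℓ.a = 12 by omega]; decide⟩

/-- **COVER LEMMA.** Inside the ring-4 alphabet, the only ample cover of a `Q` letter `(12; x', y')`, `|x'| = |y'| = 1`, is the `D` letter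
`(10; 2x', 2y')`: an admissible P-letter amply below a `Q` letter is a `D` letter. -/
theorem isD_of_ample_isQ {ℓ ℓ' : Letter} (hP : PAdm ℓ) (hQ : isQ ℓ' = true) (hA : AmpleAbove ℓ ℓ') : isD ℓ = true := by
  obtain ⟨⟨hh, _⟩, hc, hx, hy⟩ := hP
  unfold Letter.height at hh
  unfold Letter.colevel at hc
  simp only [isQ, Bool.and_eq_true, decide_eq_true_eq] at hQ
  obtain ⟨⟨ha', hx'⟩, hy'⟩ := hQ
  obtain ⟨hlt, hsq⟩ := hA
  have hx1 : 1 ≤ |ℓ.x| := Int.one_le_abs hx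
  have hy1 : 1 ≤ |ℓ.y| := Int.one_le_abs hy
  have ex := sq_abs_sub_abs_le ℓ.x ℓ'.x
  have ey := sq_abs_sub_abs_le ℓ.y ℓ'.y
  rw [hx'] at ex
  rw [hy'] at ey
  rw [ha'] at hlt hsq
  have key : (|ℓ.x| - 1) ^ 2 + (|ℓ.y| - 1) ^ 2 < (12 - ℓ.a) ^ 2 := by linarith
  simp only [isD, Bool.and_eq_true, decide_eq_true_eq]
  rcases (show (|ℓ.x| = 1 ∧ |ℓ.y| = 1) ∨ (|ℓ.x| = 2 ∧ |ℓ.y| = 1) ∨ (|ℓ.x| = 1 ∧ |ℓ.y| = 2) ∨ (|ℓ.x| = 3 ∧ |ℓ.y| = 1)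
      ∨ (|ℓ.x| = 1 ∧ |ℓ.y| = 3) ∨ (|ℓ.x| = 2 ∧ |ℓ.y| = 2) by omega) with
    ⟨hu, hv⟩ | ⟨hu, hv⟩ | ⟨hu, hv⟩ | ⟨hu, hv⟩ | ⟨hu, hv⟩ | ⟨hu, hv⟩
  · exfalso; omega
  · exfalso; rw [hu, hv, show ℓ.a = 11 by omega] at key; norm_num at key
  · exfalso; rw [hu, hv, show ℓ.a = 11 by omega] at key; norm_num at key
  · exfalso; rw [hu, hv, show ℓ.a = 10 by omega] at key; norm_num at key
  · exfalso; rw [hu, hv, show ℓ.a = 10 by omega] at key; norm_num at key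
  · exact ⟨⟨by omega, hu⟩, hv⟩

/-- number of `D` slots of a cell -/
def dcount (x : Cell) : ℕ := (isD (x 0)).toNat + (isD (x 1)).toNat + (isD (x 2)).toNat + (isD (x 3)).toNat
/-- number of `Q` slots of a cell -/
def qcount (y : Cell) : ℕ := (isQ (y 0)).toNat + (isQ (y 1)).toNat + (isQ (y 2)).toNat + (isQ (y 3)).toNat

theorem toNat_le_one' (b : Bool) : b.toNat ≤ 1 := by cases b <;> simp

theorem toNat_mono {a b : Bool} (h : a = true → b = true) : a.toNat ≤ b.toNat := by
  cases a <;> cases b <;> simp_all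

theorem toNat_eq_zero' {b : Bool} (h : b.toNat = 0) : b = false := by
  cases b <;> simp_all

theorem dcount_le_four (x : Cell) : dcount x ≤ 4 := by
  unfold dcount
  have h0 := toNat_le_one' (isD (x 0)); have h1 := toNat_le_one' (isD (x 1))
  have h2 := toNat_le_one' (isD (x 2)); have h3 := toNat_le_one' (isD (x 3))
  omega

/-- Along a live arrow `x → y` (x admissible), `#Q(y) ≤ #D(x)`. -/
theorem qcount_le_dcount {x y : Cell} (hx : ∀ f, PAdm (x f)) (hl : Live x y) : qcount y ≤ dcount x := by
  unfold qcount dcount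
  have h : ∀ f, (isQ (y f)).toNat ≤ (isD (x f)).toNat :=
    fun f => toNat_mono fun hq => isD_of_ample_isQ (hx f) hq (hl f)
  have h0 := h 0; have h1 := h 1; have h2 := h 2; have h3 := h 3
  omega

/-! ## §5 From the finite checks to bounds on admissible CELLS -/

theorem norm_cellCoef_eeee (c : Cell) :
    (cellCoef c Word.eeee).norm = (c 0).bnorm * (c 1).bnorm * (c 2).bnorm * (c 3).bnorm := by
  have hb : ∀ ℓ : Letter, (star ℓ.beta).norm = ℓ.bnorm := fun ℓ => by
    rw [Zsqrtd.norm_conj, Zsqrtd.norm_def]; simp [Letter.beta, Letter.bnorm]; ring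
  rw [cellCoef_eeee, Fin.prod_univ_four, Zsqrtd.norm_mul, Zsqrtd.norm_mul, Zsqrtd.norm_mul, hb, hb, hb, hb]

theorem re_sq_le_norm (z : GaussianInt) : z.re ^ 2 ≤ z.norm := by
  rw [Zsqrtd.norm_def]; nlinarith [sq_nonneg z.im]

theorem im_sq_le_norm (z : GaussianInt) : z.im ^ 2 ≤ z.norm := by
  rw [Zsqrtd.norm_def]; nlinarith [sq_nonneg z.re]

/-- Branch `k ≥ 1`, P side: `−G(x) + Y·[#D(x) = k] ≤ L` for an admissible P-cell with `#D ≤ k`. -/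
theorem P_bound (k : ℕ) (γ : Coefs) (L Y : ℤ) (hchk : chkP k γ L Y = true) (x : Cell) (hx : ∀ f, PAdm (x f))
    (hk : dcount x ≤ k) : -Gcell γ x + Y * (if dcount x = k then 1 else 0) ≤ L := by
  have hK : ∀ f, ∃ K, PRep (x f) K := fun f => exists_PRep (hx f)
  choose K hK using hK
  have hG : Gcell γ x = GP γ (K 0) (K 1) (K 2) (K 3) := by
    simp only [Gcell, GP, (hK 0).1, (hK 0).2.1, (hK 1).1, (hK 1).2.1, (hK 2).1, (hK 2).2.1, (hK 3).1, (hK 3).2.1]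
  have hc : dcount x = cntD (K 0) (K 1) (K 2) (K 3) := by
    simp only [dcount, cntD, (hK 0).2.2.2, (hK 1).2.2.2, (hK 2).2.2.2, (hK 3).2.2.2]
  rw [hG, hc]
  rw [hc] at hk
  exact chkP_spec k γ L Y hchk _ _ _ _ hk

/-- Branch `k ≥ 1`, N side: `G(y) ≤ L` for an admissible N-cell with `#Q ≤ k`. -/
theorem N_bound (k : ℕ) (γ : Coefs) (L : ℤ) (hchk : chkN k γ L = true) (y : Cell) (hy : ∀ f, NAdm (y f))
    (hk : qcount y ≤ k) : Gcell γ y ≤ L := by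
  have hK : ∀ f, ∃ K, NRep (y f) K := fun f => exists_NRep (hy f)
  choose K hK using hK
  have hG : Gcell γ y = GN γ (K 0) (K 1) (K 2) (K 3) := by
    simp only [Gcell, GN, (hK 0).1, (hK 0).2.1, (hK 1).1, (hK 1).2.1, (hK 2).1, (hK 2).2.1, (hK 3).1, (hK 3).2.1]
  have hc : qcount y = cntQ (K 0) (K 1) (K 2) (K 3) := by
    simp only [qcount, cntQ, (hK 0).2.2.1, (hK 1).2.2.1, (hK 2).2.2.1, (hK 3).2.2.1]
  rw [hG]
  rw [hc] at hk
  exact chkN_spec k γ L hchk _ _ _ _ hk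

/-- Branch `0`, P side: `L·|proj ∏β̄| ≤ −G(x)` for every `D`-free admissible P-cell and every coordinate `proj ∈ {re, im}`. -/
theorem P0_bound (γ : Coefs) (L : ℤ) (hL : 0 ≤ L) (hchk : chkP0 γ L = true) (x : Cell) (hx : ∀ f, PAdm (x f))
    (h0 : dcount x = 0) (proj : GaussianInt → ℤ) (hproj : ∀ z, proj z ^ 2 ≤ z.norm) :
    L * |proj (cellCoef x Word.eeee)| ≤ -Gcell γ x := by
  have hK : ∀ f, ∃ K, PRep (x f) K := fun f => exists_PRep (hx f)
  choose K hK using hK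
  have hG : Gcell γ x = GP γ (K 0) (K 1) (K 2) (K 3) := by
    simp only [Gcell, GP, (hK 0).1, (hK 0).2.1, (hK 1).1, (hK 1).2.1, (hK 2).1, (hK 2).2.1, (hK 3).1, (hK 3).2.1]
  have hc : dcount x = cntD (K 0) (K 1) (K 2) (K 3) := by
    simp only [dcount, cntD, (hK 0).2.2.2, (hK 1).2.2.2, (hK 2).2.2.2, (hK 3).2.2.2]
  have hn : (cellCoef x Word.eeee).norm = (K 0).bv * (K 1).bv * (K 2).bv * (K 3).bv := by
    rw [norm_cellCoef_eeee, (hK 0).2.2.1, (hK 1).2.2.1, (hK 2).2.2.1, (hK 3).2.2.1]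
  rw [hc] at h0
  obtain ⟨hle, hsq⟩ := chkP0_spec γ L hchk _ _ _ _ h0
  rw [← hG] at hle hsq
  rw [← hn] at hsq
  have h1 : (L * proj (cellCoef x Word.eeee)) ^ 2 ≤ (-Gcell γ x) ^ 2 := by
    have := hproj (cellCoef x Word.eeee)
    nlinarith
  have h2 := abs_le_of_sq_le_sq h1 (by linarith)
  rwa [abs_mul, abs_of_nonneg hL] at h2

/-- Branch `0`, N side: `L·|proj ∏β̄| ≤ G(y)` for every `Q`-free admissible N-cell. -/
theorem N0_bound (γ : Coefs) (L : ℤ) (hL : 0 ≤ L) (hchk : chkN0 γ L = true) (y : Cell) (hy : ∀ f, NAdm (y f))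
    (h0 : qcount y = 0) (proj : GaussianInt → ℤ) (hproj : ∀ z, proj z ^ 2 ≤ z.norm) :
    L * |proj (cellCoef y Word.eeee)| ≤ Gcell γ y := by
  have hK : ∀ f, ∃ K, NRep (y f) K := fun f => exists_NRep (hy f)
  choose K hK using hK
  have hG : Gcell γ y = GN γ (K 0) (K 1) (K 2) (K 3) := by
    simp only [Gcell, GN, (hK 0).1, (hK 0).2.1, (hK 1).1, (hK 1).2.1, (hK 2).1, (hK 2).2.1, (hK 3).1, (hK 3).2.1]
  unfold qcount at h0
  have hq0 : (K 0).isQ = false := by rw [← (hK 0).2.2.1]; apply toNat_eq_zero'; omega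
  have hq1 : (K 1).isQ = false := by rw [← (hK 1).2.2.1]; apply toNat_eq_zero'; omega
  have hq2 : (K 2).isQ = false := by rw [← (hK 2).2.2.1]; apply toNat_eq_zero'; omega
  have hq3 : (K 3).isQ = false := by rw [← (hK 3).2.2.1]; apply toNat_eq_zero'; omega
  have hc : cntQ (K 0) (K 1) (K 2) (K 3) = 0 := by simp [cntQ, hq0, hq1, hq2, hq3]
  have hn : (cellCoef y Word.eeee).norm = ((K 0).sv * (K 1).sv * (K 2).sv * (K 3).sv) ^ 2 := by
    rw [norm_cellCoef_eeee, (hK 0).2.2.2 hq0, (hK 1).2.2.2 hq1, (hK 2).2.2.2 hq2, (hK 3).2.2.2 hq3]; ring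
  have hs : 0 ≤ (K 0).sv * (K 1).sv * (K 2).sv * (K 3).sv :=
    mul_nonneg (mul_nonneg (mul_nonneg (NC.sv_nonneg _) (NC.sv_nonneg _)) (NC.sv_nonneg _)) (NC.sv_nonneg _)
  have hle := chkN0_spec γ L hchk _ _ _ _ hc
  rw [← hG] at hle
  have h1 : proj (cellCoef y Word.eeee) ^ 2 ≤ ((K 0).sv * (K 1).sv * (K 2).sv * (K 3).sv) ^ 2 := by
    rw [← hn]; exact hproj _
  have h2 := abs_le_of_sq_le_sq h1 hs
  calc L * |proj (cellCoef y Word.eeee)| ≤ L * ((K 0).sv * (K 1).sv * (K 2).sv * (K 3).sv) :=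
        mul_le_mul_of_nonneg_left h2 hL
    _ ≤ Gcell γ y := hle

/-! ## §6 Designs: admissibility of supported letters, the K-disjunction, the two branch theorems -/

theorem P_adm (D : Design) (hA : D.OnAlphabet 14) (h4 : D.A4)
    (hc : ∀ c ∈ D.suppN ++ D.suppP, ∀ f : Fin 4, (c f).colevel ≤ 4) : ∀ x ∈ D.suppP, ∀ f, PAdm (x f) := by
  intro x hx f
  obtain ⟨y, hy, hlive⟩ := h4.1 x hx
  have hxA : (x f).OnAlphabet 14 := hA x (List.mem_append.mpr (Or.inr hx)) f
  have hyA : (y f).OnAlphabet 14 := hA y (List.mem_append.mpr (Or.inl hy)) f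
  have hnotaxis : ¬ (x f).isAxis := fun hax =>
    no_ample_cover_of_axis (x f) (y f) (hxA.1.trans hyA.1.symm) hax (hlive f)
  unfold Letter.isAxis at hnotaxis
  have hxx : (x f).x ≠ 0 := fun h0 => hnotaxis (by rw [h0]; ring)
  have hxy : (x f).y ≠ 0 := fun h0 => hnotaxis (by rw [h0]; ring)
  exact ⟨hxA, hc x (List.mem_append.mpr (Or.inr hx)) f, hxx, hxy⟩

theorem N_adm (D : Design) (hA : D.OnAlphabet 14) (h4 : D.A4)
    (hc : ∀ c ∈ D.suppN ++ D.suppP, ∀ f : Fin 4, (c f).colevel ≤ 4) : ∀ y ∈ D.suppN, ∀ f, NAdm (y f) := by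
  intro y hy f
  obtain ⟨x, hx, hlive⟩ := h4.2 y hy
  have hxA : (x f).OnAlphabet 14 := hA x (List.mem_append.mpr (Or.inr hx)) f
  have hyA : (y f).OnAlphabet 14 := hA y (List.mem_append.mpr (Or.inl hy)) f
  have hdrop := colevel_drop_two (x f) (y f) (hxA.1.trans hyA.1.symm) (hlive f)
  have hcx := hc x (List.mem_append.mpr (Or.inr hx)) f
  exact ⟨hyA, by linarith⟩

theorem N_qcount (D : Design) (hA : D.OnAlphabet 14) (h4 : D.A4)
    (hc : ∀ c ∈ D.suppN ++ D.suppP, ∀ f : Fin 4, (c f).colevel ≤ 4) :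
    ∀ y ∈ D.suppN, ∃ x ∈ D.suppP, qcount y ≤ dcount x := by
  intro y hy
  obtain ⟨x, hx, hlive⟩ := h4.2 y hy
  exact ⟨x, hx, qcount_le_dcount (P_adm D hA h4 hc x hx) hlive⟩

theorem mu_zero_of_suppP_nil (D : Design) (h4 : D.A4) (hnil : D.suppP = []) : D.mu = 0 := by
  have hPzero : ∀ cm ∈ D.P, cm.2 = 0 := by
    intro cm hcm
    by_contra hne
    have hmem : cm.1 ∈ D.suppP := (mem_suppP_iff D cm.1).mpr ⟨cm.2, by simpa using hcm, Nat.pos_of_ne_zero hne⟩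
    rw [hnil] at hmem
    simp at hmem
  have hNzero : ∀ cm ∈ D.N, cm.2 = 0 := by
    intro cm hcm
    by_contra hne
    have hmem : cm.1 ∈ D.suppN := (mem_suppN_iff D cm.1).mpr ⟨cm.2, by simpa using hcm, Nat.pos_of_ne_zero hne⟩
    obtain ⟨x, hx, _⟩ := h4.2 cm.1 hmem
    rw [hnil] at hx
    simp at hx
  have hN0 := wsum_eq_zero_of_mults_zero D.N (fun c => cellCoef c Word.eeee) hNzero
  have hP0 := wsum_eq_zero_of_mults_zero D.P (fun c => cellCoef c Word.eeee) hPzero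
  unfold Design.mu Design.T
  rw [hN0, hP0]
  simp

/-- **Branch `k ≥ 1`.** If some supported P-cell `x₀` has exactly `k` `D`-slots, all supported P-cells have `≤ k` `D`-slots and all
supported N-cells `≤ k` `Q`-slots, then a certificate `(γ, L, Y)` (`Y ≥ 0`) passing `chkN k`∕`chkP k` forces `Y ≤ L·M`. -/
theorem branch_pos (D : Design) (h1 : D.A1) (hP : ∀ x ∈ D.suppP, ∀ f, PAdm (x f)) (hN : ∀ y ∈ D.suppN, ∀ f, NAdm (y f))
    (k : ℕ) (x₀ : Cell) (hx₀ : x₀ ∈ D.suppP) (hk₀ : dcount x₀ = k)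
    (hmaxP : ∀ x ∈ D.suppP, dcount x ≤ k) (hmaxN : ∀ y ∈ D.suppN, qcount y ≤ k)
    (γ : Coefs) (L Y : ℤ) (hY : 0 ≤ Y) (hcN : chkN k γ L = true) (hcP : chkP k γ L Y = true) :
    Y ≤ L * (D.copies : ℤ) := by
  let ind : Cell → ℤ := fun c => if dcount c = k then 1 else 0
  have hNle : linZ D.N (Gcell γ) ≤ L * ((D.N.map Prod.snd).sum : ℕ) := by
    refine linZ_le_mul_sum D.N (Gcell γ) L fun cm hcm hpos => ?_
    have hmem : cm.1 ∈ D.suppN := (mem_suppN_iff D cm.1).mpr ⟨cm.2, by simpa using hcm, hpos⟩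
    exact N_bound k γ L hcN cm.1 (hN cm.1 hmem) (hmaxN cm.1 hmem)
  have hPle : linZ D.P (fun c => (-1) * Gcell γ c + Y * ind c) ≤ L * ((D.P.map Prod.snd).sum : ℕ) := by
    refine linZ_le_mul_sum D.P _ L fun cm hcm hpos => ?_
    have hmem : cm.1 ∈ D.suppP := (mem_suppP_iff D cm.1).mpr ⟨cm.2, by simpa using hcm, hpos⟩
    have := P_bound k γ L Y hcP cm.1 (hP cm.1 hmem) (hmaxP cm.1 hmem)
    linarith
  have hsplit : linZ D.P (fun c => (-1) * Gcell γ c + Y * ind c) = (-1) * linZ D.P (Gcell γ) + Y * linZ D.P ind := by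
    rw [linZ_add, linZ_smul, linZ_smul]
  have hvan := G_vanishes D h1 γ
  obtain ⟨m₀, hm₀, hpos₀⟩ := (mem_suppP_iff D x₀).mp hx₀
  have hind0 : ∀ c, 0 ≤ ind c := fun c => by
    show 0 ≤ (if dcount c = k then (1 : ℤ) else 0)
    split <;> norm_num
  have hind1 : (m₀ : ℤ) * ind x₀ ≤ linZ D.P ind := term_le_linZ D.P ind hind0 x₀ m₀ hm₀
  have hx1 : ind x₀ = 1 := by
    show (if dcount x₀ = k then (1 : ℤ) else 0) = 1
    rw [if_pos hk₀]
  have hm1 : (1 : ℤ) ≤ m₀ := by exact_mod_cast hpos₀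
  have hge : 1 ≤ linZ D.P ind := by rw [hx1, mul_one] at hind1; linarith
  have hYle : Y ≤ Y * linZ D.P ind := by nlinarith
  unfold Design.copies
  rw [Nat.cast_add]
  rw [hsplit] at hPle
  linarith

/-- **Branch `0`.** If no supported P-cell has a `D`-slot (hence no supported N-cell a `Q`-slot), a certificate `(γ, L)` with `L > 0`
passing `chkN0`∕`chkP0` forces `μ = 0`. -/
theorem branch_zero (D : Design) (h1 : D.A1) (hP : ∀ x ∈ D.suppP, ∀ f, PAdm (x f)) (hN : ∀ y ∈ D.suppN, ∀ f, NAdm (y f))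
    (hmaxP : ∀ x ∈ D.suppP, dcount x = 0) (hmaxN : ∀ y ∈ D.suppN, qcount y = 0)
    (γ : Coefs) (L : ℤ) (hL : 0 < L) (hcN : chkN0 γ L = true) (hcP : chkP0 γ L = true) : D.mu = 0 := by
  have key : ∀ proj : GaussianInt → ℤ, (∀ z, proj z ^ 2 ≤ z.norm) →
      (proj D.mu = linZ D.N (fun c => proj (cellCoef c Word.eeee)) - linZ D.P (fun c => proj (cellCoef c Word.eeee))) →
      proj D.mu = 0 := by
    intro proj hproj hmu
    have hNpt : ∀ cm ∈ D.N, 0 < cm.2 → L * |proj (cellCoef cm.1 Word.eeee)| ≤ Gcell γ cm.1 := by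
      intro cm hcm hpos
      have hmem : cm.1 ∈ D.suppN := (mem_suppN_iff D cm.1).mpr ⟨cm.2, by simpa using hcm, hpos⟩
      exact N0_bound γ L hL.le hcN cm.1 (hN cm.1 hmem) (hmaxN cm.1 hmem) proj hproj
    have hPpt : ∀ cm ∈ D.P, 0 < cm.2 → L * |proj (cellCoef cm.1 Word.eeee)| ≤ (-1) * Gcell γ cm.1 := by
      intro cm hcm hpos
      have hmem : cm.1 ∈ D.suppP := (mem_suppP_iff D cm.1).mpr ⟨cm.2, by simpa using hcm, hpos⟩
      have := P0_bound γ L hL.le hcP cm.1 (hP cm.1 hmem) (hmaxP cm.1 hmem) proj hproj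
      linarith
    have hN' : L * linZ D.N (fun c => |proj (cellCoef c Word.eeee)|) ≤ linZ D.N (Gcell γ) := by
      rw [← linZ_smul]; exact linZ_mono _ _ _ hNpt
    have hP' : L * linZ D.P (fun c => |proj (cellCoef c Word.eeee)|) ≤ (-1) * linZ D.P (Gcell γ) := by
      rw [← linZ_smul, ← linZ_smul]; exact linZ_mono _ _ _ hPpt
    have habs : |proj D.mu| ≤ linZ D.N (fun c => |proj (cellCoef c Word.eeee)|)
        + linZ D.P (fun c => |proj (cellCoef c Word.eeee)|) := by
      rw [hmu]
      calc |linZ D.N (fun c => proj (cellCoef c Word.eeee)) - linZ D.P (fun c => proj (cellCoef c Word.eeee))|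
          ≤ |linZ D.N (fun c => proj (cellCoef c Word.eeee))| + |linZ D.P (fun c => proj (cellCoef c Word.eeee))| :=
            abs_sub _ _
        _ ≤ _ := add_le_add (abs_linZ_le _ _) (abs_linZ_le _ _)
    have hvan := G_vanishes D h1 γ
    have hfin : L * |proj D.mu| ≤ 0 := by nlinarith
    have habs0 : |proj D.mu| ≤ 0 := by
      have h' : L * |proj D.mu| ≤ L * 0 := by rw [mul_zero]; exact hfin
      exact le_of_mul_le_mul_left h' hL
    exact abs_eq_zero.mp (le_antisymm habs0 (abs_nonneg _))
  have hre : D.mu.re = 0 := key Zsqrtd.re re_sq_le_norm (by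
    unfold Design.mu; rw [T_eq_linG, Zsqrtd.re_sub, re_linG, re_linG])
  have him : D.mu.im = 0 := key Zsqrtd.im im_sq_le_norm (by
    unfold Design.mu; rw [T_eq_linG, Zsqrtd.im_sub, im_linG, im_linG])
  exact Zsqrtd.ext hre him

/-! ## §7 RING 4 IS EMPTY -/

/-- **RING 4 IS EMPTY** (kernel): on the height-14 alphabet there is no (A1)-clean (A4) design with `μ ≠ 0`, all supported letters of
co-level `≤ 4`, and copy count `M ≤ B`, for any `B ≤ 997` and any rank floor (the rank hypothesis is idle). -/
theorem ringsEmpty_colevel_four (B : ℕ) (hB : B ≤ 997) (rmin : ℤ) : RingsEmpty 14 B rmin 4 := by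
  intro D hA h1 h4 hμ hcop _ hc
  have hP := P_adm D hA h4 hc
  have hN := N_adm D hA h4 hc
  have hNQ := N_qcount D hA h4 hc
  by_cases hnil : D.suppP = []
  · exact hμ (mu_zero_of_suppP_nil D h4 hnil)
  have hne : D.suppP.toFinset.Nonempty := by
    rw [Finset.nonempty_iff_ne_empty, Ne, List.toFinset_eq_empty_iff]
    exact hnil
  obtain ⟨x₀, hx₀', hmax'⟩ := D.suppP.toFinset.exists_max_image dcount hne
  have hx₀ : x₀ ∈ D.suppP := List.mem_toFinset.mp hx₀'
  have hmaxP : ∀ x ∈ D.suppP, dcount x ≤ dcount x₀ := fun x hx => hmax' x (List.mem_toFinset.mpr hx)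
  have hmaxN : ∀ y ∈ D.suppN, qcount y ≤ dcount x₀ := fun y hy => by
    obtain ⟨x, hx, hle⟩ := hNQ y hy
    exact le_trans hle (hmaxP x hx)
  have hcopZ : (D.copies : ℤ) ≤ 997 := by exact_mod_cast le_trans hcop hB
  have h4' := dcount_le_four x₀
  rcases (show dcount x₀ = 0 ∨ dcount x₀ = 1 ∨ dcount x₀ = 2 ∨ dcount x₀ = 3 ∨ dcount x₀ = 4 by omega) with
    hk | hk | hk | hk | hk
  · exact hμ (branch_zero D h1 hP hN (fun x hx => by have := hmaxP x hx; omega)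
      (fun y hy => by have := hmaxN y hy; omega) γ0 7598136 (by norm_num) chkN0_ok chkP0_ok)
  · rw [hk] at hmaxP hmaxN
    have := branch_pos D h1 hP hN 1 x₀ hx₀ hk hmaxP hmaxN γ1 0 234240 (by norm_num) chkN1_ok chkP1_ok
    linarith
  · rw [hk] at hmaxP hmaxN
    have := branch_pos D h1 hP hN 2 x₀ hx₀ hk hmaxP hmaxN γ2 24 29232 (by norm_num) chkN2_ok chkP2_ok
    linarith
  · rw [hk] at hmaxP hmaxN
    have := branch_pos D h1 hP hN 3 x₀ hx₀ hk hmaxP hmaxN γ3 576 574944 (by norm_num) chkN3_ok chkP3_ok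
    linarith
  · rw [hk] at hmaxP hmaxN
    have := branch_pos D h1 hP hN 4 x₀ hx₀ hk hmaxP hmaxN γ4 192 410304 (by norm_num) chkN4_ok chkP4_ok
    linarith

/-- The instance of record: **`RingsEmpty 14 199 8 4`**. -/
theorem ringsEmpty_14_199_8_4 : RingsEmpty 14 199 8 4 := ringsEmpty_colevel_four 199 (by norm_num) 8

/-- Leg A assembled at `c₀ = 4`: the conjecture of record may be RELAXED to `DepthBound 14 199 8 4` — it alone now closes the widened (A4)
road at `M ≤ 199`, `r ≥ 8` (ring 4 is a theorem; cf. `a4_closed_of_depthBound_three`). -/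
theorem a4_closed_of_depthBound_four (hd : DepthBound 14 199 8 4) :
    ∀ D : Design, D.OnAlphabet 14 → D.A1 → D.A4 → D.mu ≠ 0 → D.copies ≤ 199 → 8 ≤ D.rank → False :=
  a4_closed_of_depthBound_and_rings 14 199 8 4 hd ringsEmpty_14_199_8_4

/-- … and `DepthBound 14 199 8 3` (the registered stub's statement) implies the relaxed form, so nothing owed got harder. -/
theorem depthBound_four_of_three (hd : DepthBound 14 199 8 3) : DepthBound 14 199 8 4 :=
  depthBound_mono 14 199 199 8 8 3 4 le_rfl le_rfl (by norm_num) hd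

end Summit.HodgeConjecture.HodgeConjecture.Cruxes.BlochSeedDiscOne.RingFourEmpty
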